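import Literature.Geometry.Lorentzian.DocStationarySpacetime
import Literature.Geometry.Lorentzian.AxisymmetricBlackHoleUniquenessProofs
import HarnessLib

/-!
# The domain of outer communications of a stationary-axisymmetric black hole as an
`ℝ × U(1)`-symmetric space-time (Chruściel–Costa 2008, §3, §5–§6; Chruściel–Costa–Heusler 2012, §3.2)

Companion of `DocStationarySpacetime.lean` (the open sub-space-time
`(⟨⟨M_ext⟩⟩, g|, τ|)` = `StationaryAFBlackHole.docSpacetime 𝓑 hF hP` with the restricted
stationary Killing field `docKilling = T|⟨⟨M_ext⟩⟩`) for the stationary-AXISYMMETRIC setting of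
Chruściel–Costa–Heusler's Theorem 3.2 (`ChruscielCostaHeusler2012_axisymmetricUniqueness`,
hypothesis `IsStationaryAxisymmetric`: an axisymmetric Killing field `Y` with `[T, Y] = 0`). The
whole reduction of Chruściel–Costa, Astérisque 321 (2008) = arXiv:0806.0016, §§5–6 (area function,
orbit space `⟨⟨M_ext⟩⟩/(ℝ × U(1))`, Weyl coordinates, Ernst map) takes place on `⟨⟨M_ext⟩⟩`
regarded as a space-time invariant under the commutative group `ℝ × U(1)` (§3, p. 9: "we assume
the existence of a commutative group of isometries `ℝ × 𝕋^{s-1}`"; §7.1: "the analysis of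
Section 5 applies"). That `⟨⟨M_ext⟩⟩` IS invariant under the axial flow is, in the tree, the
theorem `StationaryAFBlackHole.image_flow_doc` of `AxisymmetricBlackHoleUniquenessProofs.lean`
(every Killing flow commuting with the stationary one preserves `⟨⟨M_ext⟩⟩`, by achronality of
the event horizons — no asymptotic analysis). This file draws the structural consequence:

* `StationaryAFBlackHole.mem_doc_of_isMIntegralCurve_of_mlieBracket_eq_zero` — the integral
  curves through `⟨⟨M_ext⟩⟩` of a complete Killing field commuting with `T` stay in `⟨⟨M_ext⟩⟩`;
* `StationaryAFBlackHole.docAxial 𝓑 hF hP Y = Y|⟨⟨M_ext⟩⟩` (a definition with body) with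
  `isKillingField_docAxial` (Killing fields restrict to open sub-space-times, O'Neill 1983, Ch. 9,
  Prop. 9.25 with Ch. 3, p. 57), `leviCivita_docAxial_apply` (`∇^{g|}(Y|) = (∇^g Y)|`),
  `isCompleteVectorField_docAxial` (**`Y|⟨⟨M_ext⟩⟩` is complete** — this is where the invariance
  of `⟨⟨M_ext⟩⟩` enters), `periodic_of_isMIntegralCurve_docAxial` (its orbits are `2π`-periodic),
  `mlieBracket_docKilling_docAxial` (**`[T|, Y|] = 0`**, naturality of the Lie bracket under the
  open embedding, Mathlib's `VectorField.mpullback_mlieBracket`);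
* `StationaryAFBlackHole.exists_mem_doc_apply_ne_zero` — an axisymmetric Killing field does not
  vanish identically on `⟨⟨M_ext⟩⟩` (one-jet rigidity of complete Killing fields, O'Neill 1983,
  Ch. 9, Lemma 9.28, and locality of `∇`);
* `StationaryAFBlackHole.isAxisymmetricKilling_docAxial` — hence, as soon as the axis
  `𝒜 = {Y = 0}` meets `⟨⟨M_ext⟩⟩`, **`(⟨⟨M_ext⟩⟩, g|, τ|)` carries the axisymmetric Killing field `Y|` commuting with its stationary Killing field `T|`**:
  the `ℝ × U(1)`-symmetric, connected, chronological (`IsIPlusRegular.isChronological_docSpacetime`),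
  vacuum (`isRicciFlat_docMetric`) space-time on which Chruściel–Costa's §§5–6 operate. (That the
  axis does meet `⟨⟨M_ext⟩⟩` — indeed `M_ext` — is part of the asymptotic analysis of axial Killing
  vectors, Beig–Chruściel 1996/1997, not formalised; it is kept as a hypothesis.)

* for an `I⁺`-regular hole, the standing properties of that space-time used in §§3–5:
  `isSpacelike_docAxial` ("each `K_i` spacelike in `⟨⟨M_ext⟩⟩`", §3, p. 9),
  `docKilling_add_smul_docAxial_ne_zero` (Cor. 3.8: `K₀ + Ω K₁ ≠ 0` on `⟨⟨M_ext⟩⟩`),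
  `linearIndependent_docKilling_docAxial` (`T|, Y|` independent off the axis, §5.2, p. 19).

Everything is proved; the one definition has a body; no named fact is introduced (D-0026).

## References

* P. T. Chruściel, J. L. Costa, *On uniqueness of stationary vacuum black holes*, Astérisque 321
  (2008) 195–265, arXiv:0806.0016, §3 (p. 9), §5 (p. 18), §6.1, §7.1 (key `ChruscielCosta2008`).
* P. T. Chruściel, J. L. Costa, M. Heusler, *Stationary black holes: uniqueness and beyond*,
  Living Rev. Relativity 15 (2012) 7, arXiv:1205.6112, §3.2.1 and Thm. 3.2
  (key `ChruscielCostaHeusler2012`).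
* B. O'Neill, *Semi-Riemannian geometry*, Academic Press 1983, Ch. 1 (Prop. 1.56: the bracket of
  `f`-related fields), Ch. 3, p. 57 and Prop. 3.59, Ch. 9, Prop. 9.25 (key `ONeillSemiRiemannian1983`).
-/

noncomputable section

open Bundle Set Function Filter TopologicalSpace Manifold VectorField
open scoped Manifold ContDiff Topology

namespace Literature.Geometry.Lorentzian

universe u

namespace StationaryAFBlackHole

/-! ### Orbits of commuting complete Killing fields through `⟨⟨M_ext⟩⟩` -/

/-- **The integral curves through `⟨⟨M_ext⟩⟩` of a complete Killing field `K` commuting with the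
stationary one stay in `⟨⟨M_ext⟩⟩`**: `K` has a global smooth flow `ψ` (Lee 2012, Thm. 9.12,
`exists_contMDiff_globalFlow_of_complete`), every integral curve is a flow line
(`eq_flow_of_isMIntegralCurve`), and the flow maps preserve `⟨⟨M_ext⟩⟩`
(`StationaryAFBlackHole.flow_mem_iff`). Chruściel–Costa 2008, §3 (p. 9) and §6.1.
[cite: ChruscielCosta2008, §3 (p. 9) and §6.1] -/
theorem mem_doc_of_isMIntegralCurve_of_mlieBracket_eq_zero {𝓑 : StationaryAFBlackHole.{u}}
    [𝓑.metric.HasLeviCivita] {K : Π x : 𝓑.carrier, TangentSpace (𝓡 4) x}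
    (hK : 𝓑.metric.IsKillingField K) (hKc : IsCompleteVectorField K)
    (hTK : ∀ x, VectorField.mlieBracket (𝓡 4) 𝓑.killing K x = 0) {γ : ℝ → 𝓑.carrier}
    (hγ : IsMIntegralCurve γ K) (h0 : γ 0 ∈ 𝓑.doc) (t : ℝ) : γ t ∈ 𝓑.doc := by
  have hKs : ContMDiff (𝓡 4) (𝓡 4).tangent ∞
      (fun x ↦ (⟨x, K x⟩ : TangentBundle (𝓡 4) 𝓑.carrier)) := hK.contMDiff
  have hc : ∀ x : 𝓑.carrier, ∃ δ : ℝ → 𝓑.carrier, δ 0 = x ∧ IsMIntegralCurve δ K := fun x ↦ by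
    obtain ⟨δ, hδ, hδ0⟩ := hKc x
    exact ⟨δ, hδ0, hδ⟩
  obtain ⟨ψ, hψ, hψ0, hψadd, hψK⟩ :=
    Literature.Geometry.Manifold.exists_contMDiff_globalFlow_of_complete (I := 𝓡 4) (n := ⊤)
      (by exact_mod_cast hKs) le_top hc
  have hψ' : ContMDiff (𝓘(ℝ, ℝ).prod (𝓡 4)) (𝓡 4) ∞ ψ := by exact_mod_cast hψ
  have hψ2 : ContMDiff (𝓘(ℝ, ℝ).prod (𝓡 4)) (𝓡 4) 2 ψ := hψ'.of_le (WithTop.coe_le_coe.mpr le_top)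
  have hK1 : ContMDiff (𝓡 4) (𝓡 4).tangent 1
      (fun x ↦ (⟨x, K x⟩ : TangentBundle (𝓡 4) 𝓑.carrier)) :=
    hKs.of_le (WithTop.coe_le_coe.mpr le_top)
  rw [eq_flow_of_isMIntegralCurve hK1 hψK hψ0 hγ t]
  exact (flow_mem_iff hK hTK hψ2 hψ0 hψadd hψK t (γ 0)).1.2 h0

variable (𝓑 : StationaryAFBlackHole.{u})
  (hF : 𝓑.metric.isOpen_chronologicalFuture 𝓑.timeOrientation)
  (hP : 𝓑.metric.isOpen_chronologicalPast 𝓑.timeOrientation)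

/-! ### The axial Killing field read on `⟨⟨M_ext⟩⟩` -/

/-- **A vector field `Y` read on `⟨⟨M_ext⟩⟩`**: `Y|⟨⟨M_ext⟩⟩ (y) = Y(↑y)` (`T_y ⟨⟨M_ext⟩⟩ = T_y M`;
meant for the axial Killing field `K₁` of Chruściel–Costa 2008, §5, p. 18). [cite: ChruscielCosta2008, §5 (p. 18)] -/
def docAxial (Y : Π x : 𝓑.carrier, TangentSpace (𝓡 4) x) :
    Π y : 𝓑.docOpens hF hP, TangentSpace (𝓡 4) y :=
  fun y ↦ Y y.1

/-- Unfolding lemma for `docAxial`. [folklore] -/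
@[simp]
theorem docAxial_apply (Y : Π x : 𝓑.carrier, TangentSpace (𝓡 4) x) (y : 𝓑.docOpens hF hP) :
    𝓑.docAxial hF hP Y y = Y y.1 := rfl

/-- `Y|⟨⟨M_ext⟩⟩` is the pullback `ι^* Y` along the inclusion (`mpullback_subtypeVal`). [folklore] -/
theorem mpullback_subtypeVal_eq_docAxial (Y : Π x : 𝓑.carrier, TangentSpace (𝓡 4) x) :
    mpullback (𝓡 4) (𝓡 4) (Subtype.val : 𝓑.docOpens hF hP → 𝓑.carrier) Y = 𝓑.docAxial hF hP Y :=
  mpullback_subtypeVal (𝓑.docOpens hF hP) Y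

/-- The axis of `Y|⟨⟨M_ext⟩⟩` is `𝒜 ∩ ⟨⟨M_ext⟩⟩`: `Y|(y) = 0 ↔ Y(↑y) = 0`. [folklore] -/
theorem docAxial_eq_zero_iff (Y : Π x : 𝓑.carrier, TangentSpace (𝓡 4) x) (y : 𝓑.docOpens hF hP) :
    𝓑.docAxial hF hP Y y = 0 ↔ Y y.1 = 0 := Iff.rfl

variable {Y : Π x : 𝓑.carrier, TangentSpace (𝓡 4) x}

/-- `Y|⟨⟨M_ext⟩⟩` is `C^∞` if `Y` is (restriction of a smooth section to an open submanifold).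
[folklore] -/
theorem contMDiff_docAxial
    (hY : ContMDiff (𝓡 4) (𝓡 4).tangent ∞
      (fun x ↦ (TotalSpace.mk' E4 x (Y x) : TangentBundle (𝓡 4) 𝓑.carrier))) :
    ContMDiff (𝓡 4) (𝓡 4).tangent ∞ (fun y : 𝓑.docOpens hF hP ↦
      (TotalSpace.mk' E4 y (𝓑.docAxial hF hP Y y) : TangentBundle (𝓡 4) (𝓑.docOpens hF hP))) :=
  Literature.Geometry.Manifold.OpenSubmanifold.contMDiff_tangentSection hY (𝓑.docOpens hF hP)

variable [𝓑.metric.HasLeviCivita]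

/-- **A Killing field restricts to a Killing field of `⟨⟨M_ext⟩⟩`**: `Y|⟨⟨M_ext⟩⟩` is Killing for
`g|⟨⟨M_ext⟩⟩` (the restricted metric is the pullback along the inclusion, and Killing fields pull
back under local isometries, `IsKillingField.comap_mpullback`; as for `isKillingField_docKilling`).
O'Neill 1983, Ch. 9, Prop. 9.25 with Ch. 3, p. 57. [cite: ONeillSemiRiemannian1983, Ch. 9, Prop. 9.25] -/
theorem isKillingField_docAxial (hY : 𝓑.metric.IsKillingField Y) :
    (𝓑.docMetric hF hP).IsKillingField (𝓑.docAxial hF hP Y) := by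
  set gc := 𝓑.metric.toPseudoRiemannianMetric.comap
    PseudoRiemannianMetric.contMDiff_pullbackBilin_holds
    (Subtype.val : 𝓑.docOpens hF hP → 𝓑.carrier) contMDiff_subtype_val
    (injective_mfderiv_subtypeVal (𝓑.docOpens hF hP)) rfl with hgc_def
  haveI hgcLC : gc.HasLeviCivita := gc.hasLeviCivita
  have hgc : (𝓑.docMetric hF hP).toPseudoRiemannianMetric = gc :=
    PseudoRiemannianMetric.restrict_eq_comap 𝓑.metric.toPseudoRiemannianMetric (𝓑.docOpens hF hP)
  have key : gc.IsKillingField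
      (mpullback (𝓡 4) (𝓡 4) (Subtype.val : 𝓑.docOpens hF hP → 𝓑.carrier) Y) :=
    PseudoRiemannianMetric.IsKillingField.comap_mpullback 𝓑.metric.toPseudoRiemannianMetric
      PseudoRiemannianMetric.contMDiff_pullbackBilin_holds contMDiff_subtype_val
      (injective_mfderiv_subtypeVal (𝓑.docOpens hF hP)) rfl hY
  rw [mpullback_subtypeVal_eq_docAxial] at key
  exact (PseudoRiemannianMetric.isKillingField_congr_metric hgc inferInstance hgcLC _).2 key

/-- **`Y|⟨⟨M_ext⟩⟩` is complete** for a complete Killing field `Y` commuting with `T`: its integral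
curve through `↑y` stays in `⟨⟨M_ext⟩⟩` (`mem_doc_of_isMIntegralCurve_of_mlieBracket_eq_zero` — the
invariance of the domain of outer communications under the axial flow) and, read in the open
submanifold, is a whole-line integral curve of `Y|` (`isMIntegralCurve_codRestrict`). This is the
completeness of the `U(1)`-generator on the space-time `⟨⟨M_ext⟩⟩` of Chruściel–Costa 2008, §5
(Thm. 5.1: "periodic Killing vector `K₁`, jointly generating an `ℝ × U(1)` subgroup").
[cite: ChruscielCosta2008, §5 (Thm. 5.1) and §6.1] -/
theorem isCompleteVectorField_docAxial (hY : 𝓑.metric.IsKillingField Y)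
    (hYc : IsCompleteVectorField Y) (hTY : ∀ x, VectorField.mlieBracket (𝓡 4) 𝓑.killing Y x = 0) :
    IsCompleteVectorField (𝓑.docAxial hF hP Y) := by
  intro y
  obtain ⟨γ, hγ, h0⟩ := hYc y.1
  have h0doc : γ 0 ∈ 𝓑.doc := by rw [h0]; exact y.2
  have hmem : ∀ t, γ t ∈ 𝓑.docOpens hF hP := fun t ↦
    mem_doc_of_isMIntegralCurve_of_mlieBracket_eq_zero hY hYc hTY hγ h0doc t
  exact ⟨fun t ↦ ⟨γ t, hmem t⟩, isMIntegralCurve_codRestrict (𝓑.docOpens hF hP) hγ hmem,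
    Subtype.ext h0⟩

omit [𝓑.metric.HasLeviCivita] in
/-- **The orbits of `Y|⟨⟨M_ext⟩⟩` are `2π`-periodic** if those of `Y` are (an integral curve of the
restricted field is, composed with the inclusion, an integral curve of `Y`,
`isMIntegralCurve_subtypeVal_comp_iff`). Chruściel–Costa 2008, §5 ("periodic Killing vector `K₁`").
[cite: ChruscielCosta2008, §5 (Thm. 5.1)] -/
theorem periodic_of_isMIntegralCurve_docAxial
    (hper : ∀ γ : ℝ → 𝓑.carrier, IsMIntegralCurve γ Y → Function.Periodic γ (2 * Real.pi))
    {γ : ℝ → 𝓑.docOpens hF hP} (hγ : IsMIntegralCurve γ (𝓑.docAxial hF hP Y)) :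
    Function.Periodic γ (2 * Real.pi) := fun t ↦
  Subtype.ext (hper _ ((isMIntegralCurve_subtypeVal_comp_iff (V := Y) (𝓑.docOpens hF hP)).2 hγ) t)

/-- **`[T|, Y|] = 0` on `⟨⟨M_ext⟩⟩`**: the Lie bracket is natural under the open embedding
`ι : ⟨⟨M_ext⟩⟩ → M` (Mathlib's `VectorField.mpullback_mlieBracket`; O'Neill 1983, Ch. 1,
Prop. 1.56), `T| = ι^* T`, `Y| = ι^* Y`, and `ι^* 0 = 0`. This is the commutativity of the group
`ℝ × U(1)` acting on the space-time `⟨⟨M_ext⟩⟩` (Chruściel–Costa 2008, §3, p. 9; §5).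
[cite: ChruscielCosta2008, §3 (p. 9)] [cite: ONeillSemiRiemannian1983, Ch. 1, Prop. 1.56] -/
theorem mlieBracket_docKilling_docAxial (hY : 𝓑.metric.IsKillingField Y)
    (hTY : ∀ x, VectorField.mlieBracket (𝓡 4) 𝓑.killing Y x = 0) (y : 𝓑.docOpens hF hP) :
    VectorField.mlieBracket (𝓡 4) (𝓑.docKilling hF hP) (𝓑.docAxial hF hP Y) y = 0 := by
  have hT := 𝓑.isStationaryKilling.isKillingField
  have h2 : minSmoothness ℝ 2 ≤ (∞ : ℕ∞ω) := by
    simp only [minSmoothness_of_isRCLikeNormedField]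
    exact WithTop.coe_le_coe.mpr le_top
  haveI : IsManifold (𝓡 4) (minSmoothness ℝ 2) (𝓑.docOpens hF hP) := IsManifold.of_le h2
  haveI : IsManifold (𝓡 4) (minSmoothness ℝ 2) 𝓑.carrier := IsManifold.of_le h2
  rw [← mpullback_subtypeVal_killing, ← mpullback_subtypeVal_eq_docAxial,
    ← VectorField.mpullback_mlieBracket (hT.mdifferentiableAt y.1) (hY.mdifferentiableAt y.1)
      (contMDiff_subtype_val (n := ∞) y) h2]
  rw [mpullback_apply]
  simp only [hTY, map_zero]

/-- **An axisymmetric Killing field does not vanish identically on `⟨⟨M_ext⟩⟩`.** Otherwise it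
would vanish on the open set `⟨⟨M_ext⟩⟩ ∋ x₀`, so that `Y(x₀) = 0` and `∇Y(x₀) = 0` (locality of
the connection, Mathlib's `IsCovariantDerivativeOn.congr_of_eventuallyEq`), and a complete Killing
field on a connected manifold with vanishing one-jet at a point vanishes identically (O'Neill 1983,
Ch. 9, Lemma 9.28; in the tree `IsKillingField.eq_zero_of_oneJet_eq_zero`) — contradicting the
non-triviality clause of `IsAxisymmetricKilling`. [cite: ONeillSemiRiemannian1983, Ch. 9, Lemma 9.28] -/
theorem exists_mem_doc_apply_ne_zero (hY : 𝓑.toSpacetime.IsAxisymmetricKilling Y) :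
    ∃ x ∈ 𝓑.doc, Y x ≠ 0 := by
  obtain ⟨hK, hcomp, -, ⟨x₁, hx₁⟩, -⟩ := hY
  by_contra h
  push Not at h
  obtain ⟨x₀, hx₀⟩ := 𝓑.doc_nonempty
  have hdoc : IsOpen 𝓑.doc :=
    (LorentzianMetric.isOpen_chronologicalFuture_of_boundaryless 𝓑.metric 𝓑.timeOrientation
      𝓑.Mext).inter
      (LorentzianMetric.isOpen_chronologicalPast_of_boundaryless 𝓑.metric 𝓑.timeOrientation 𝓑.Mext)
  have hev : ∀ᶠ x in 𝓝 x₀, Y x = (0 : Π x : 𝓑.carrier, TangentSpace (𝓡 4) x) x :=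
    Filter.eventually_of_mem (hdoc.mem_nhds hx₀) fun x hx ↦ h x hx
  have hcov : IsCovariantDerivativeOn E4 𝓑.metric.toPseudoRiemannianMetric.leviCivitaFun univ :=
    Fact.out
  have hd : 𝓑.metric.toPseudoRiemannianMetric.leviCivita Y x₀ = 0 := by
    rw [PseudoRiemannianMetric.leviCivita_apply]
    rw [hcov.congr_of_eventuallyEq (hK.mdifferentiableAt x₀) (mdifferentiableAt_zeroSection ..)
      Filter.univ_mem hev]
    exact hcov.zero (mem_univ _)
  have hzero := hK.eq_zero_of_oneJet_eq_zero hcomp (h x₀ hx₀) hd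
  exact hx₁ (by rw [hzero]; rfl)

/-- **The domain of outer communications of a stationary-axisymmetric black hole is an
`ℝ × U(1)`-symmetric space-time.** For an axisymmetric Killing field `Y` of `𝓑` commuting with `T`
whose axis meets `⟨⟨M_ext⟩⟩`, the restriction
`Y|⟨⟨M_ext⟩⟩` is an axisymmetric Killing field of the space-time `(⟨⟨M_ext⟩⟩, g|, τ|)`
(`Spacetime.IsAxisymmetricKilling`: Killing, complete, all orbits `2π`-periodic, non-trivial, with
non-empty axis) commuting with its stationary Killing field `T|⟨⟨M_ext⟩⟩` — the setting
"`(M, g)` … with stationary Killing vector `K₀` and periodic Killing vector `K₁`, jointly generating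
an `ℝ × U(1)` subgroup of the isometry group" of Chruściel–Costa 2008, Thm. 5.1 and §§5–6, for the
space-time `⟨⟨M_ext⟩⟩` ("the analysis of Section 5 applies", §7.1), reached here WITHOUT asymptotic
analysis of `Y` except for the location of the axis (hypothesis `hax`).
[cite: ChruscielCosta2008, Thm. 5.1, §6.1 and §7.1] [cite: ChruscielCostaHeusler2012, §3.2.1 (p. 10) and Thm. 3.2] -/
theorem isAxisymmetricKilling_docAxial (hY : 𝓑.toSpacetime.IsAxisymmetricKilling Y)
    (hTY : ∀ x, VectorField.mlieBracket (𝓡 4) 𝓑.killing Y x = 0)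
    (hax : ∃ x ∈ 𝓑.doc, Y x = 0) :
    (𝓑.docSpacetime hF hP).IsAxisymmetricKilling (𝓑.docAxial hF hP Y) ∧
      ∀ y, VectorField.mlieBracket (𝓡 4) (𝓑.docKilling hF hP) (𝓑.docAxial hF hP Y) y = 0 := by
  obtain ⟨x₁, hx₁, hYx₁⟩ := 𝓑.exists_mem_doc_apply_ne_zero hY
  obtain ⟨hK, hcomp, hper, -, -⟩ := hY
  obtain ⟨x₀, hx₀, hYx₀⟩ := hax
  exact ⟨⟨𝓑.isKillingField_docAxial hF hP hK, 𝓑.isCompleteVectorField_docAxial hF hP hK hcomp hTY,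
      fun γ hγ ↦ 𝓑.periodic_of_isMIntegralCurve_docAxial hF hP hper hγ, ⟨⟨x₁, hx₁⟩, hYx₁⟩,
      ⟨⟨x₀, hx₀⟩, hYx₀⟩⟩,
    fun y ↦ 𝓑.mlieBracket_docKilling_docAxial hF hP hK hTY y⟩

/-! ### Standing properties of the `ℝ × U(1)`-symmetric space-time `⟨⟨M_ext⟩⟩` of an
`I⁺`-regular hole (Chruściel–Costa 2008, §3, p. 9, and Cor. 3.8) -/

/-- **`Y|⟨⟨M_ext⟩⟩` is spacelike (or zero) everywhere on the space-time `⟨⟨M_ext⟩⟩`** of an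
`I⁺`-regular hole — the standing assumption "each `K_i` spacelike in `⟨⟨M_ext⟩⟩`" of
Chruściel–Costa 2008, §3 (p. 9), here a theorem (`isSpacelike_of_isAxisymmetricKilling_of_mem_doc`:
closed orbits through strongly causal points are spacelike). [cite: ChruscielCosta2008, §3 (p. 9) and §5.2 (p. 19)] -/
theorem isSpacelike_docAxial (hreg : 𝓑.IsIPlusRegular) (hY : 𝓑.toSpacetime.IsAxisymmetricKilling Y)
    (y : 𝓑.docOpens hF hP) : (𝓑.docMetric hF hP).IsSpacelike (𝓑.docAxial hF hP Y y) :=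
  isSpacelike_of_isAxisymmetricKilling_of_mem_doc hreg hY y.2

/-- **On the space-time `⟨⟨M_ext⟩⟩` of an `I⁺`-regular hole the Killing fields `T| + Ω Y|` have no
zeros**, for every `Ω` (Chruściel–Costa 2008, Cor. 3.8 for `K₀ + Ω K₁`, in the tree
`IsIPlusRegular.killing_add_smul_ne_zero_of_mem_doc`). [cite: ChruscielCosta2008, Cor. 3.8] -/
theorem docKilling_add_smul_docAxial_ne_zero (hreg : 𝓑.IsIPlusRegular)
    (hY : 𝓑.toSpacetime.IsAxisymmetricKilling Y)
    (hTY : ∀ x, VectorField.mlieBracket (𝓡 4) 𝓑.killing Y x = 0) (Ω : ℝ) (y : 𝓑.docOpens hF hP) :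
    𝓑.docKilling hF hP y + Ω • 𝓑.docAxial hF hP Y y ≠ 0 :=
  hreg.killing_add_smul_ne_zero_of_mem_doc hY hTY Ω y.2

/-- **On the space-time `⟨⟨M_ext⟩⟩` of an `I⁺`-regular hole, `T|` and `Y|` are linearly
independent off the axis** ("`𝒵̃ ∩ ⟨⟨M_ext⟩⟩ = 𝒵_dgt ∩ ⟨⟨M_ext⟩⟩`", Chruściel–Costa 2008, §5.2,
p. 19; in the tree `IsIPlusRegular.linearIndependent_killing_axial_of_mem_doc`) — the hypothesis
"linearly independent commuting Killing vectors" of Thm. 5.8 on `⟨⟨M_ext⟩⟩ ∖ 𝒜`.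
[cite: ChruscielCosta2008, §5.2 (p. 19) and Thm. 5.8] -/
theorem linearIndependent_docKilling_docAxial (hreg : 𝓑.IsIPlusRegular)
    (hY : 𝓑.toSpacetime.IsAxisymmetricKilling Y)
    (hTY : ∀ x, VectorField.mlieBracket (𝓡 4) 𝓑.killing Y x = 0) {y : 𝓑.docOpens hF hP}
    (hy : 𝓑.docAxial hF hP Y y ≠ 0) :
    LinearIndependent ℝ ![𝓑.docKilling hF hP y, 𝓑.docAxial hF hP Y y] :=
  hreg.linearIndependent_killing_axial_of_mem_doc hY hTY y.2 hy

end StationaryAFBlackHole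

end Literature.Geometry.Lorentzian

end
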